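import Literature.Probability.Percolation.KSTPeriodicSymmetry
import HarnessLib

/-!
# KST-type RSW for periodic measures: decomposition of the bridge event

Topic `Literature/Probability/Percolation`. Bookkeeping for the proof of
[KohlerSchindlerTassion2023, Lemma 1(i)] ("bridges imply crossings") for `kℤ² ⋊ D₄`-periodic
positively associated measures (`Admissible k t μ`, `KSTPeriodicDefs.lean`). For a rectangle
`[L, R] × [B, T]` symmetric about `(-t/2, -t/2)` (`L + R = -t = B + T`) with thresholds
`xl + xr = -t`:

* the bridge event (left part of the boundary joined to the right part) is contained in the union
  of the left–right crossing and of the four events `𝓔` = "a part is joined to the far bottom/top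
  segment of the other side" (`parts_subset_union`), whence
  `μ(bridge) ≤ μ(LR) + 4 μ(𝓔)` (`real_parts_le`);
* the four events `𝓔` have the same probability, by the reflection `flipEquiv t` in `x₀ = -t/2`
  (`real_flip_parts`) and the reflection in `x₁ = -t/2`, which is the composite
  `transpose ∘ flip ∘ transpose` of generators of the symmetry group (`Admissible.updown_inv`,
  `real_updown_parts`).

## References

* [KohlerSchindlerTassion2023] L. Köhler-Schindler, V. Tassion, *Crossing probabilities for
  planar percolation*, Duke Math. J. 172 (2023) 809–838, §1 Symmetries, §3 (proof of Lemma 1).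
-/

namespace Literature.Probability.Percolation

open _root_.MeasureTheory LatticeModels

noncomputable section

namespace KSTPeriodic

/-! ### Composite symmetries -/

/-- The action on configurations is multiplicative: `(e₁ ≫ e₂)·ω = e₂·(e₁·ω)`. [folklore] -/
theorem act_trans_apply (e₁ e₂ : Site 2 ≃ Site 2) (ω : BondConfig (Site 2)) :
    KST2023.act (e₁.trans e₂) ω = KST2023.act e₂ (KST2023.act e₁ ω) := by
  change sym2Equiv (e₁.trans e₂) '' ω = sym2Equiv e₂ '' (sym2Equiv e₁ '' ω)
  rw [Set.image_image]
  refine Set.image_congr' fun z => ?_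
  simp [sym2Equiv_apply, Sym2.map_map]

/-- A measure invariant under two lattice symmetries is invariant under their composite.
[cite: KohlerSchindlerTassion2023, §1 Symmetries] -/
theorem map_act_trans {μ : Measure (BondConfig (Site 2))} {e₁ e₂ : Site 2 ≃ Site 2}
    (h₁ : μ.map (KST2023.act e₁) = μ) (h₂ : μ.map (KST2023.act e₂) = μ) :
    μ.map (KST2023.act (e₁.trans e₂)) = μ := by
  have : (⇑(KST2023.act (e₁.trans e₂)) : BondConfig (Site 2) → BondConfig (Site 2)) =
      KST2023.act e₂ ∘ KST2023.act e₁ := funext (act_trans_apply e₁ e₂)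
  rw [this, ← Measure.map_map (KST2023.act e₂).measurable (KST2023.act e₁).measurable, h₁, h₂]

/-- The reflection in the horizontal line `x₁ = -t/2`, `x ↦ (x₀, -t - x₁)`, is the composite
`transpose ∘ flip ∘ transpose`. [cite: KohlerSchindlerTassion2023, §1 Symmetries] -/
theorem updown_apply (t : ℕ) (x : Site 2) :
    (transposeEquiv.trans ((flipEquiv t).trans transposeEquiv)) x = ![x 0, -(t : ℤ) - x 1] := by
  ext i; fin_cases i <;> simp

variable {k t : ℕ} {μ : Measure (BondConfig (Site 2))}

/-- An admissible measure is invariant under the reflection in `x₁ = -t/2`.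
[cite: KohlerSchindlerTassion2023, §1 Symmetries and Comment 1] -/
theorem Admissible.updown_inv (hμ : Admissible k t μ) :
    μ.map (KST2023.act (transposeEquiv.trans ((flipEquiv t).trans transposeEquiv))) = μ :=
  map_act_trans hμ.transpose_inv (map_act_trans hμ.flip_inv hμ.transpose_inv)

/-! ### Images of the pieces of the boundary -/

/-- `flipEquiv t` is an involution. [folklore] -/
theorem flipEquiv_involutive (t : ℕ) : Function.Involutive (flipEquiv t) := fun x => by
  ext i; fin_cases i <;> simp

/-- The reflection in `x₁ = -t/2` is an involution. [folklore] -/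
theorem updown_involutive (t : ℕ) :
    Function.Involutive (transposeEquiv.trans ((flipEquiv t).trans transposeEquiv)) := fun x => by
  rw [updown_apply, updown_apply]
  ext i; fin_cases i <;> simp

/-- Membership in the image of a set under the involution `flipEquiv t`. [folklore] -/
theorem mem_image_flipEquiv {t : ℕ} {A : Set (Site 2)} {x : Site 2} :
    x ∈ flipEquiv t '' A ↔ flipEquiv t x ∈ A :=
  Set.mem_image_iff_of_inverse (flipEquiv_involutive t).leftInverse (flipEquiv_involutive t).rightInverse

/-- Membership in the image of a set under the reflection in `x₁ = -t/2`. [folklore] -/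
theorem mem_image_updown {t : ℕ} {A : Set (Site 2)} {x : Site 2} :
    x ∈ (transposeEquiv.trans ((flipEquiv t).trans transposeEquiv)) '' A ↔
      (transposeEquiv.trans ((flipEquiv t).trans transposeEquiv)) x ∈ A :=
  Set.mem_image_iff_of_inverse (updown_involutive t).leftInverse (updown_involutive t).rightInverse

/-- A rectangle symmetric about `x₀ = -t/2` is invariant under `flipEquiv t`. [folklore] -/
theorem image_flip_rect_symm {L R : ℤ} (hLR : L + R = -(t : ℤ)) (B T : ℤ) :
    flipEquiv t '' rect L R B T = rect L R B T := by
  ext x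
  rw [mem_image_flipEquiv]
  simp only [mem_rect, flipEquiv_apply, Matrix.cons_val_zero, Matrix.cons_val_one]
  omega

/-- `flipEquiv t` maps the left part of the boundary of a symmetric rectangle (left column, or
top/bottom row at abscissa `≤ xl`) onto the right part (thresholds `xl + xr = -t`). [folklore] -/
theorem image_flip_leftPart {L R B T xl xr : ℤ} (hLR : L + R = -(t : ℤ)) (hx : xl + xr = -(t : ℤ)) :
    flipEquiv t '' {x | x ∈ rect L R B T ∧ (x 0 = L ∨ ((x 1 = T ∨ x 1 = B) ∧ x 0 ≤ xl))} =
      {x | x ∈ rect L R B T ∧ (x 0 = R ∨ ((x 1 = T ∨ x 1 = B) ∧ xr ≤ x 0))} := by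
  ext x
  rw [mem_image_flipEquiv]
  simp only [Set.mem_setOf_eq, mem_rect, flipEquiv_apply, Matrix.cons_val_zero, Matrix.cons_val_one]
  omega

/-- `flipEquiv t` maps the right segment `{x₁ = y, xr ≤ x₀}` of a row of a symmetric rectangle onto
the left segment `{x₁ = y, x₀ ≤ xl}` (`xl + xr = -t`). [folklore] -/
theorem image_flip_segment {L R B T xl xr : ℤ} (hLR : L + R = -(t : ℤ)) (hx : xl + xr = -(t : ℤ))
    (y : ℤ) :
    flipEquiv t '' {x | x ∈ rect L R B T ∧ x 1 = y ∧ xr ≤ x 0} =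
      {x | x ∈ rect L R B T ∧ x 1 = y ∧ x 0 ≤ xl} := by
  ext x
  rw [mem_image_flipEquiv]
  simp only [Set.mem_setOf_eq, mem_rect, flipEquiv_apply, Matrix.cons_val_zero, Matrix.cons_val_one]
  omega

/-- A rectangle symmetric about `x₁ = -t/2` is invariant under the reflection in that line.
[folklore] -/
theorem image_updown_rect_symm (L R : ℤ) {B T : ℤ} (hBT : B + T = -(t : ℤ)) :
    (transposeEquiv.trans ((flipEquiv t).trans transposeEquiv)) '' rect L R B T = rect L R B T := by
  ext x
  rw [mem_image_updown]
  simp only [mem_rect, updown_apply, Matrix.cons_val_zero, Matrix.cons_val_one]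
  omega

/-- The left part of the boundary of a rectangle symmetric about `x₁ = -t/2` is invariant under
the reflection in that line. [folklore] -/
theorem image_updown_leftPart {L R B T : ℤ} (hBT : B + T = -(t : ℤ)) (xl : ℤ) :
    (transposeEquiv.trans ((flipEquiv t).trans transposeEquiv)) ''
        {x | x ∈ rect L R B T ∧ (x 0 = L ∨ ((x 1 = T ∨ x 1 = B) ∧ x 0 ≤ xl))} =
      {x | x ∈ rect L R B T ∧ (x 0 = L ∨ ((x 1 = T ∨ x 1 = B) ∧ x 0 ≤ xl))} := by
  ext x
  rw [mem_image_updown]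
  simp only [Set.mem_setOf_eq, mem_rect, updown_apply, Matrix.cons_val_zero, Matrix.cons_val_one]
  omega

/-- The reflection in `x₁ = -t/2` maps the bottom-right segment of a symmetric rectangle onto its
top-right segment. [folklore] -/
theorem image_updown_segment {L R B T : ℤ} (hBT : B + T = -(t : ℤ)) (xr : ℤ) :
    (transposeEquiv.trans ((flipEquiv t).trans transposeEquiv)) ''
        {x | x ∈ rect L R B T ∧ x 1 = B ∧ xr ≤ x 0} =
      {x | x ∈ rect L R B T ∧ x 1 = T ∧ xr ≤ x 0} := by
  ext x
  rw [mem_image_updown]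
  simp only [Set.mem_setOf_eq, mem_rect, updown_apply, Matrix.cons_val_zero, Matrix.cons_val_one]
  omega

/-! ### The four corner events have the same probability -/

/-- Reflection in `x₀ = -t/2`: "left part joined to the right segment of the row `y`" and "right
part joined to the left segment of the row `y`" are equally likely.
[cite: KohlerSchindlerTassion2023, §3, proof of Lemma 1 (invariance under symmetries)] -/
theorem real_flip_parts (hμ : Admissible k t μ) {L R B T xl xr : ℤ} (hLR : L + R = -(t : ℤ))
    (hx : xl + xr = -(t : ℤ)) (y : ℤ) :
    μ.real (openCrossing (rect L R B T)
        {x | x ∈ rect L R B T ∧ (x 0 = R ∨ ((x 1 = T ∨ x 1 = B) ∧ xr ≤ x 0))}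
        {x | x ∈ rect L R B T ∧ x 1 = y ∧ x 0 ≤ xl}) =
      μ.real (openCrossing (rect L R B T)
        {x | x ∈ rect L R B T ∧ (x 0 = L ∨ ((x 1 = T ∨ x 1 = B) ∧ x 0 ≤ xl))}
        {x | x ∈ rect L R B T ∧ x 1 = y ∧ xr ≤ x 0}) := by
  have h := real_openCrossing_image hμ.flip_inv (rect L R B T)
    {x | x ∈ rect L R B T ∧ (x 0 = L ∨ ((x 1 = T ∨ x 1 = B) ∧ x 0 ≤ xl))}
    {x | x ∈ rect L R B T ∧ x 1 = y ∧ xr ≤ x 0}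
  rw [image_flip_rect_symm hLR B T, image_flip_leftPart hLR hx, image_flip_segment hLR hx y] at h
  exact h

/-- Reflection in `x₁ = -t/2`: "left part joined to the top-right segment" and "left part joined to
the bottom-right segment" are equally likely.
[cite: KohlerSchindlerTassion2023, §3, proof of Lemma 1 (invariance under symmetries)] -/
theorem real_updown_parts (hμ : Admissible k t μ) {L R B T : ℤ} (hBT : B + T = -(t : ℤ)) (xl xr : ℤ) :
    μ.real (openCrossing (rect L R B T)
        {x | x ∈ rect L R B T ∧ (x 0 = L ∨ ((x 1 = T ∨ x 1 = B) ∧ x 0 ≤ xl))}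
        {x | x ∈ rect L R B T ∧ x 1 = T ∧ xr ≤ x 0}) =
      μ.real (openCrossing (rect L R B T)
        {x | x ∈ rect L R B T ∧ (x 0 = L ∨ ((x 1 = T ∨ x 1 = B) ∧ x 0 ≤ xl))}
        {x | x ∈ rect L R B T ∧ x 1 = B ∧ xr ≤ x 0}) := by
  have h := real_openCrossing_image hμ.updown_inv (rect L R B T)
    {x | x ∈ rect L R B T ∧ (x 0 = L ∨ ((x 1 = T ∨ x 1 = B) ∧ x 0 ≤ xl))}
    {x | x ∈ rect L R B T ∧ x 1 = B ∧ xr ≤ x 0}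
  rw [image_updown_rect_symm L R hBT, image_updown_leftPart hBT xl, image_updown_segment hBT xr] at h
  exact h

/-! ### Decomposition of the bridge event -/

/-- Union bound for five events. [folklore] -/
theorem measureReal_union₅_le {α : Type*} [MeasurableSpace α] {ν : Measure α} (A B C D E : Set α) :
    ν.real (A ∪ B ∪ C ∪ D ∪ E) ≤ ν.real A + ν.real B + ν.real C + ν.real D + ν.real E := by
  have h1 := measureReal_union_le (μ := ν) (A ∪ B ∪ C ∪ D) E
  have h2 := measureReal_union_le (μ := ν) (A ∪ B ∪ C) D
  have h3 := measureReal_union_le (μ := ν) (A ∪ B) C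
  have h4 := measureReal_union_le (μ := ν) A B
  linarith

/-- **Realisations of the bridge event.** A connection from the left part of the boundary (left
column, or top/bottom row at abscissa `≤ xl`) to the right part is a left–right crossing, or joins
a part to the far bottom/top segment of the opposite side.
[cite: KohlerSchindlerTassion2023, §3, proof of Lemma 1 (we first distinguish possible realizations)] -/
theorem parts_subset_union (L R B T xl xr : ℤ) :
    (openCrossing (rect L R B T)
        {x | x ∈ rect L R B T ∧ (x 0 = L ∨ ((x 1 = T ∨ x 1 = B) ∧ x 0 ≤ xl))}
        {x | x ∈ rect L R B T ∧ (x 0 = R ∨ ((x 1 = T ∨ x 1 = B) ∧ xr ≤ x 0))} :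
        Set (BondConfig (Site 2))) ⊆
      lrRect L R B T ∪
        openCrossing (rect L R B T)
          {x | x ∈ rect L R B T ∧ (x 0 = L ∨ ((x 1 = T ∨ x 1 = B) ∧ x 0 ≤ xl))}
          {x | x ∈ rect L R B T ∧ x 1 = B ∧ xr ≤ x 0} ∪
        openCrossing (rect L R B T)
          {x | x ∈ rect L R B T ∧ (x 0 = R ∨ ((x 1 = T ∨ x 1 = B) ∧ xr ≤ x 0))}
          {x | x ∈ rect L R B T ∧ x 1 = B ∧ x 0 ≤ xl} ∪
        openCrossing (rect L R B T)
          {x | x ∈ rect L R B T ∧ (x 0 = L ∨ ((x 1 = T ∨ x 1 = B) ∧ x 0 ≤ xl))}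
          {x | x ∈ rect L R B T ∧ x 1 = T ∧ xr ≤ x 0} ∪
        openCrossing (rect L R B T)
          {x | x ∈ rect L R B T ∧ (x 0 = R ∨ ((x 1 = T ∨ x 1 = B) ∧ xr ≤ x 0))}
          {x | x ∈ rect L R B T ∧ x 1 = T ∧ x 0 ≤ xl} := by
  rintro ω ⟨x, hx, y, hy, hxy⟩
  rcases hy.2 with hy0 | ⟨hy1 | hy1, hyr⟩
  · rcases hx.2 with hx0 | ⟨hx1 | hx1, hxl⟩
    · exact Or.inl (Or.inl (Or.inl (Or.inl ⟨x, ⟨hx.1, hx0⟩, y, ⟨hy.1, hy0⟩, hxy⟩)))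
    · refine Or.inr ⟨y, ⟨hy.1, Or.inl hy0⟩, x, ⟨hx.1, hx1, hxl⟩, ?_⟩
      rwa [openConnIn_comm]
    · refine Or.inl (Or.inl (Or.inr ⟨y, ⟨hy.1, Or.inl hy0⟩, x, ⟨hx.1, hx1, hxl⟩, ?_⟩))
      rwa [openConnIn_comm]
  · exact Or.inl (Or.inr ⟨x, hx, y, ⟨hy.1, hy1, hyr⟩, hxy⟩)
  · exact Or.inl (Or.inl (Or.inl (Or.inr ⟨x, hx, y, ⟨hy.1, hy1, hyr⟩, hxy⟩)))

/-- **`μ(bridge) ≤ μ(LR) + 4 μ(𝓔)`** for a rectangle symmetric about `(-t/2, -t/2)` and an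
admissible measure: union bound over the realisations, the four corner events being equally
likely. [cite: KohlerSchindlerTassion2023, §3, proof of Lemma 1] -/
theorem real_parts_le [IsFiniteMeasure μ] (hμ : Admissible k t μ) {L R B T xl xr : ℤ}
    (hLR : L + R = -(t : ℤ)) (hBT : B + T = -(t : ℤ)) (hx : xl + xr = -(t : ℤ)) :
    μ.real (openCrossing (rect L R B T)
        {x | x ∈ rect L R B T ∧ (x 0 = L ∨ ((x 1 = T ∨ x 1 = B) ∧ x 0 ≤ xl))}
        {x | x ∈ rect L R B T ∧ (x 0 = R ∨ ((x 1 = T ∨ x 1 = B) ∧ xr ≤ x 0))}) ≤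
      μ.real (lrRect L R B T) +
        4 * μ.real (openCrossing (rect L R B T)
          {x | x ∈ rect L R B T ∧ (x 0 = L ∨ ((x 1 = T ∨ x 1 = B) ∧ x 0 ≤ xl))}
          {x | x ∈ rect L R B T ∧ x 1 = B ∧ xr ≤ x 0}) := by
  have h2 := real_flip_parts hμ (B := B) (T := T) hLR hx B
  have h3 := real_updown_parts hμ (L := L) (R := R) hBT xl xr
  have h4 := real_flip_parts hμ (B := B) (T := T) hLR hx T
  have h := (measureReal_mono (parts_subset_union L R B T xl xr) (measure_ne_top μ _)).trans
    (measureReal_union₅_le (ν := μ) _ _ _ _ _)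
  rw [h2, h4, h3] at h
  linarith

end KSTPeriodic

end

end Literature.Probability.Percolation
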